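import Literature.MathematicalPhysics.QuantumFieldTheory.Balaban1983to89.B8Eq155KLevelLocal
import Literature.MathematicalPhysics.QuantumFieldTheory.Balaban1983to89.B8Eq156KLevelLocal
import Literature.MathematicalPhysics.QuantumFieldTheory.Balaban1983to89.B8Prop3Holder
import Literature.MathematicalPhysics.QuantumFieldTheory.Balaban1983to89.B8Eq155KLevelLiteral

/-!
# `Balaban1983to89.B8Prop3KLevel` — [Balaban1985RegularSpaces] **Proposition 3** (p. 87) «(1.40)–(1.42) + (1.61) ⇒ (1.62)
# with B₁ = 5dLB₀» AT `k` LEVELS FOR A GENERAL FAMILY `{Ω_j}_{j ≤ k}` AND A GENERAL BACKGROUND `U₀`, in print's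
# multi-level norms `|·|_(α) = sup_j sup_{Ω_j}(Lʲη)^{−α}|·|`, the Theorem-3.3-of-[4] bounds (1.59) being the inputs

statement-level skeleton of published theorems with citation tags; proofs where landed; nothing here is a claim about the Yang–Mills mass gap

T. Bałaban, *Spaces of regular gauge field configurations on a lattice and gauge fixing conditions*, Commun.
Math. Phys. **99** (1985) 75–102 `[Balaban1985RegularSpaces]` ("B8"; printed page = PDF page + 74), pp. 86–87
[PDF 12–13]; [3] = [Balaban1985Averaging], [4] = [Balaban1985BackgroundPropagators].  PDF held:
`paper:balaban1985-cmp99-regular-spaces-gauge-fixing` (pp. 83, 86, 87 read as text).  STATUS: published, refereed.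

CITATION HEADER (lean-in-tree rule).  Cell `pub-ymgap` (YM Track A, DAG node N05 = [B8], HUMAN RULING D-0062), seat
`pub-ymgap-dag-n05-b` (FIRST-MISSING-ESTIMATE of Theorem 2 p. 83), gen 0; third section module of the k-level «on Ω_j»
reading of Sect. B.  WHAT IS REPRODUCED = lit-balaban SKELETON row **B8.Prop3** in print's generality: the tree's
`B8Prop3Concrete.prop3_norms_of_small` / `prop3_concrete` (p40) assemble pp. 86–87 AT ONE LEVEL `j` WITH (1.40)/(1.41)
READ GLOBALLY ON `ℤᵈ` (its HONEST SCOPE (i): «print's multi-level «on Ω_j» localisation of Sect. C is … not re-examined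
here»); this file assembles the SAME printed one-page argument over a general nested family `{Ω_j}_{j ≤ k}` with print's
LEVEL-WISE hypotheses, from the k-level (1.55) (`B8Eq155KLevelLocal.eq155_norm_kLevel_hermitian`) and the k-level (1.56)
(`B8Eq156KLevelLocal.wsup_B1_le_kLevel`), the real-arithmetic bootstrap `B8.apriori_160` / `B8.apriori_162` unchanged.
Kind «kernel-checked proof», theorems only: no `def`, no `… : Prop` fact, no existing module modified.  REUSED BY NAME:
the two companions, `B8.apriori_160`, `B8.apriori_162`, `B8ScaledSupNorm.{bondNorm, msup, Bdd, pointwise_of_bondNorm_le,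
bdd_of_forall, weight_mul_norm_le_msup, weight_neg_natCast}`, `B8Eq155JBound.{wsup, wsup_nonneg, expCfg_iEta_mem_U1}`,
`B7Prop2Explicit.{unitaryUnits, unitaryUnits_le_U1, avgClosed_unitaryUnits}`, `B8Prop3Holder.{apriori_160_fifth, apriori_162_fifth}`,
`B8Eq155KLevelLiteral.{bound_side_of_lit, grad_side_of_lit}`, `B9Eq340HolderZd.{hquot, AdmPair, hquot_nonneg}`.

## THE PRINTED TEXT (pp. 86–87 [PDF 12–13])

«Theorem 3.3 of [4] implies the bounds: |A|_(−1), |∇^η_{U₀}A|_(−2), |D^{η*}_{U₀}D^η_{U₀}A|_(−3), |Δ^η_{U₀}A|_(−3)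
≦ B₀(|J|_(−3) + |B₁|) ≦ B₀(2α₀ + 36dα₂|∇^η_{U₀}A|_(−2) + 50dα₂³ + 10dα₀α₂ + 2dLα₁ + C₂α₂²). (1.59)  Let us take this bound
for |∇^η_{U₀}A|_(−2) on the left-hand side, and let us assume that B₀36dα₂ ≦ 1/2. … (1.60)  Now we assume further that
2α₂² + 20dα₀α₂ + 2C₂α₂² ≦ α₀ + α₁. (1.61)  This and the previous inequality give finally |A| < 5dLB₀(α₀ + α₁)(Lʲη)⁻¹,
|∇^η_{U₀}A| < 5dLB₀(α₀ + α₁)(Lʲη)⁻², …, |D^{η*}_{U₀}D^η_{U₀}A|, |Δ^η_{U₀}A| < 5dLB₀(α₀ + α₁)(Lʲη)⁻³ on Ω_j. (1.62)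
Proposition 3. If U₀, U₁U₀ satisfy (1.40)–(1.42) with α₀, α₁, α₂ bounded by a constant depending on d and L only, and α₂
satisfies the additional restriction (1.61), then U₁ satisfies (1.36)–(1.39) with B₁ = 5dLB₀, B₂(β₀) = 5dLB₀(β₀), where
B₀, B₀(β₀) are the corresponding norms of the operators G(U₀), H(U₀), and depend on d and L only, B₀(β₀) on β₀ also.»

## WHAT IS CERTIFIED HERE (kernel; axioms `propext` / `Classical.choice` / `Quot.sound`)

On the `ℤᵈ` carriers of the lineage, `𝔸` a C⋆-algebra, `U₀` unitary-valued, `A` Hermitian (`U₁ = e^{iηA}`), a family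
`Ω : ℕ → Set (Site d)` of site domains and `Λ : ℕ → Set (Site d × Fin d)` of constraint bonds of the `j`-lattices (every site
of the box of a `c ∈ Λ_j` in `Ω_j`), `η > 0`, `L ≥ 2`:
* §1 **`prop3_norms_kLevel`** — the norm form of (1.62) at `k` levels: from (1.40) `U₀, U₁U₀ ∈ 𝔄_k({Ω_j}, α₀)`, (1.41) on
  `SideTouches (Ω j)` (LOCATED READING (i) of the companions), (1.42) on `Λ_j`, the windows of the inputs, «B₀36dα₂ ≦ 1/2»,
  `50dα₂ ≤ 1`, (1.61) with any `C₂ ≥ C₂(d, α₀)`, and the four (1.59) bounds in the k-level currency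
  `nJ = |J|_(−3) := B8ScaledSupNorm.bondNorm … (−3) Ω J`, `nB = |B₁| := sup_{j ≤ k, c ∈ Λ_j}‖LʲηQ_jA(c)‖`, gradient datum `g`:
  `a, g, j₂, l ≤ 5dLB₀(α₀ + α₁)`.
* §2 **`prop3_pointwise_A_kLevel`** — (1.62) first member AS PRINTED «|A| < 5dLB₀(α₀ + α₁)(Lʲη)⁻¹ on Ω_j», `j ≤ k`, when
  `a := |A|_(−1)` is the k-level norm of `A` over the bonds touching `Ω_j`; **`prop3_pointwise_grad_kLevel`** — the second
  member «|∇^η_{U₀}A| < 5dLB₀(α₀ + α₁)(Lʲη)⁻²» on `SideTouches (Ω j)` when `g` is the corresponding weighted supremum.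
* §2b **`prop3_fifth_kLevel`** — the HÖLDER MEMBER «B₂(β₀) = 5dLB₀(β₀)» at `k` levels for any quantity `h` obeying the Hölder
  line of (1.59) with its own constant `B₀(β)` (`B8Prop3Holder.apriori_160_fifth` / `apriori_162_fifth` BY NAME): `h ≤ 5dLB₀(β)(α₀ + α₁)`.
* §2c **`prop3_pointwise_holder_kLevel`** — the third member of (1.62) pointwise when `h` is the k-level weighted supremum of
  the (1,β)-quotients of [4] (3.40) (`B9Eq340HolderZd.hquot`) over the admissible pairs starting in `Ω_j`.
* §4 **`prop3_norms_kLevel_literal`** — §1 with (1.41) and the gradient datum read in print's LITERAL p. 77 bond convention along a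
  nested family with `Ω₀ = T_η` (companion `B8Eq155KLevelLiteral`): located reading (i) discharged, constants `α₂ ↦ Lα₂`,
  `g ↦ L²g`, `B₀ ↦ L²B₀`.
* §3 **`prop3_kLevel`** — PROPOSITION 3 in print's quantifier shape at `k` levels: `∃ c = c(d, L, B₀) > 0` such that for
  `0 < α₀, α₁, α₂ ≤ c` with (1.61) (`C₂ = C₂(d)`) the level-wise (1.40)–(1.42) and the (1.59) inputs give (1.62) in norm form
  and its first member pointwise «on Ω_j».

## HONEST SCOPE / LOCATED READING — what is NOT claimed

(i) As in the companions: (1.41) and the gradient datum live on `SideTouches (Ω j)` ⊇ the bonds touching `Ω_j` (G-B8-16);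
(1.42)'s box hypothesis `hbox` = «Λ_j ⊂ Ω_j^{(j)}» taken as a hypothesis on `(Ω, Λ)`.  (ii) The four (1.59) bounds are
HYPOTHESES (row B8.Eq1.59 = Theorem 3.3 of [4] + (1.57)–(1.58); a hypothesis of DAG node N05); consequently the Landau clause
of (1.42) and «(3.35) of [4]» of (1.40), used only inside (1.57)–(1.59), do not appear.  (iii) The Hölder member enters §2b as a
real `h` with its (1.59)-line; §2c reads `h` as the k-level weighted supremum of the quotients of [4] (3.40) (no new seminorm object;
`B9Eq340HolderZd.hquot` by name, one layer of pairs `x ∈ Ω_j`, `|x − x′| ≤ 1`); the third and fourth members are carried as reals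
`j₂`, `l`.  (iv) Windows: those of `B8Eq156Prop4` /
`B8Eq155KLevelLocal` (`C₀α₀ ≤ 1/3`, `4α₀ ≤ c₂′`, `e^{4cα₀}(1 + 8C₁α₂) ≤ 2`, `2α₂ ≤ c₃`, `16α₂ ≤ 1`, `5α₂(d − 1) ≤ 4`); §3
derives them all from ONE threshold `c(d, L, B₀)` (the threshold of the one-level `B8Prop3Concrete.prop3_concrete`), with
(1.61) at `C₂(d) = 2097152(d+1)² ≥ C₂(d, α₀)`; `d ≥ 2` (plaquettes exist; print: `d = 3, 4`).  (v) `T_η` ↦ `ℤᵈ`; conclusions `≤` for print's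
`<`.  Nothing here is progress on the summit; value = Proposition 3's printed argument assembled at `k` levels for a
general family and background, modulo the named [4]-leaf.
-/

noncomputable section

open scoped BigOperators
open NormedSpace

namespace Literature.MathematicalPhysics.QuantumFieldTheory.Balaban1983to89.B8Prop3KLevel

open B7Prop1Explicit (U1)
open B7Prop1Local (InBox loK bondHiK)
open B7Prop2Explicit (C0 c2' unitaryUnits unitaryUnits_le_U1 avgClosed_unitaryUnits)
open B7Prop3Flat (c3)
open B7Prop4GeneralLevels (logCovIter linCovIter)
open B8Lemma1NonAbelian (mulCfg)
open B8Ineq132 (covDerivFwd InAk BondTouches)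
open B8Eq146AExpansion (iEta expCfg)
open B8Eq155JBound (Jcur wsup)
open B8Eq140Level (SideTouches)
open B8ScaledSupNorm (bondNorm msup weight Bdd)
open B8Eq155KLevelLocal (eq155_norm_kLevel_hermitian)
open B8Eq156KLevelLocal (wsup_B1_le_kLevel)

-- `Site` alone would resolve to the torus sites of `Setup.lean`; re-export the `ℤ^d` sites of `B7Prop1Explicit`.
export B7Prop1Explicit (Site)

variable {d : ℕ} {𝔸 : Type*} [CStarAlgebra 𝔸] [Nontrivial 𝔸]

/-! ## §1 (1.62) in norm form at `k` levels -/

omit [Nontrivial 𝔸] in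
/-- In dimension `d ≥ 2` every direction has a second, distinct direction (the plaquettes of Sect. B exist). [folklore] -/
private theorem exists_ne_dir (hd2 : 2 ≤ d) (μ : Fin d) : ∃ κ : Fin d, κ ≠ μ := by
  by_cases h : (μ : ℕ) = 0
  · exact ⟨⟨1, by omega⟩, fun e => by have := congrArg Fin.val e; simp [h] at this⟩
  · exact ⟨⟨0, by omega⟩, fun e => by have := congrArg Fin.val e; simp at this; omega⟩

omit [Nontrivial 𝔸] in
/-- For `d ≥ 2`, a bond touching `S` is a side of a plaquette touching `S` (`B8Eq140Level.sideTouches_of_bondTouches`), so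
(1.41) on `SideTouches S` gives (1.41) on the bonds touching `S` (p. 77 convention). [cite: Balaban1985RegularSpaces, p.77 (convention before (1.5)), (1.41) p.83] -/
theorem bound_of_sideTouches (hd2 : 2 ≤ d) {S : Set (Site d)} {A : Site d → Fin d → 𝔸} {r : ℝ}
    (h : ∀ y τ, SideTouches S y τ → ‖A y τ‖ ≤ r) (x : Site d) (μ : Fin d) (hb : BondTouches S x μ) : ‖A x μ‖ ≤ r := by
  obtain ⟨κ, hκ⟩ := exists_ne_dir hd2 μ
  exact h x μ (B8Eq140Level.sideTouches_of_bondTouches hκ hb)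

/-- **(1.40)–(1.42) + (1.61) ⇒ (1.62), NORM FORM, AT `k` LEVELS FOR A GENERAL FAMILY `{Ω_j}_{j ≤ k}`** (pp. 86–87 assembled;
`d ≥ 2`).  Data: `U₀` unitary-valued, `A` Hermitian, `Ω` the site domains, `Λ` the constraint bonds with boxes in `Ω_j`
(`hbox`).  Hypotheses: (1.40) `U₀, U₁U₀ ∈ 𝔄_k({Ω_j}, α₀)` (`h40₀`, `h40₁`); (1.41) on `SideTouches (Ω j)`, `j ≤ k` (`h41`);
a gradient datum `g ≥ 0` bounding `(Lʲη)²|(D^η_{U₀,κ}A_τ)(y)|` there (`hg`); (1.42) `‖Q_j(U₀, ηA)(c)‖ < 2dLα₁` on `Λ_j`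
(`h42`); the windows; «B₀36dα₂ ≦ 1/2», `50dα₂ ≤ 1`; (1.61) with a constant `C₂ ≥ C₂(d, α₀) = 8C₁e^{4cα₀}` (`hC₂`, `h61`);
and the four bounds (1.59) of Theorem 3.3 of [4] in the k-level currency, `nJ = |J|_(−3)` (`bondNorm … (−3) Ω J`) and
`nB = |B₁| = sup_{j ≤ k, c ∈ Λ_j}‖LʲηQ_jA(c)‖`: `a, g, j₂, l ≤ B₀(nJ + nB)`.  Conclusion (1.62) with `B₁ = 5dLB₀`:
`a, g, j₂, l ≤ 5dLB₀(α₀ + α₁)`. [cite: Balaban1985RegularSpaces, Prop. 3 (1.62) p.87; (1.55)–(1.61) p.86] -/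
theorem prop3_norms_kLevel (hd2 : 2 ≤ d) {η : ℝ} (hη : 0 < η) {L : ℕ} (hL : 2 ≤ L) {k : ℕ}
    {U₀ : Site d → Fin d → 𝔸ˣ} (hU₀ : ∀ y κ, U₀ y κ ∈ unitaryUnits 𝔸)
    {A : Site d → Fin d → 𝔸} (hAh : ∀ y κ, IsSelfAdjoint (A y κ)) {α₀ α₁ α₂ g : ℝ}
    (hα₀ : 0 < α₀) (hα₁ : 0 ≤ α₁) (hα₂ : 0 ≤ α₂) (hg0 : 0 ≤ g)
    (hα3 : C0 d * α₀ ≤ 1 / 3) (hα4 : 4 * α₀ ≤ c2' d L) (h16 : 16 * α₂ ≤ 1) (hd5 : 5 * α₂ * ((d : ℝ) - 1) ≤ 4)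
    (hsmall : Real.exp (4 * (800 * ((d : ℝ) + 1) ^ 2 * ((d : ℝ) + 4)) * α₀)
      * (1 + 8 * (131072 * ((d : ℝ) + 1) ^ 2) * α₂) ≤ 2)
    (hc₃ : 2 * α₂ ≤ c3 d L) {B₀ : ℝ} (hB₀ : 0 ≤ B₀) (hside : 36 * d * B₀ * α₂ ≤ 1 / 2) (h50 : 50 * d * α₂ ≤ 1)
    {C₂ : ℝ} (hC₂ : 8 * (131072 * ((d : ℝ) + 1) ^ 2) * Real.exp (4 * (800 * ((d : ℝ) + 1) ^ 2 * ((d : ℝ) + 4)) * α₀) ≤ C₂)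
    (h61 : 2 * α₂ ^ 2 + 20 * d * α₀ * α₂ + 2 * C₂ * α₂ ^ 2 ≤ α₀ + α₁)
    {Ω : ℕ → Set (Site d)} {Λ : ℕ → Set (Site d × Fin d)}
    (hbox : ∀ j, j ≤ k → ∀ c ∈ Λ j, ∀ x, InBox (loK L j c.1) (bondHiK L j c.1 c.2) x → x ∈ Ω j)
    (h40₀ : InAk L k η α₀ Ω U₀) (h40₁ : InAk L k η α₀ Ω (mulCfg (expCfg (iEta η A)) U₀))
    (h41 : ∀ j, j ≤ k → ∀ y τ, SideTouches (Ω j) y τ → ‖A y τ‖ ≤ α₂ * ((L : ℝ) ^ j * η)⁻¹)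
    (hg : ∀ j, j ≤ k → ∀ (y : Site d) (κ τ : Fin d), SideTouches (Ω j) y τ →
      ((L : ℝ) ^ j * η) ^ 2 * ‖covDerivFwd η U₀ κ (fun z => A z τ) y‖ ≤ g)
    (h42 : ∀ j, j ≤ k → ∀ c ∈ Λ j, ‖logCovIter L U₀ (iEta η A) j c.1 c.2‖ < 2 * d * L * α₁)
    {a j₂ l : ℝ}
    (h59a : a ≤ B₀ * (bondNorm L k η (-(3 : ℝ)) Ω (fun x μ => Jcur η U₀ A μ x)
      + wsup 1 (fun p : {p : ℕ × (Site d × Fin d) // p.1 ≤ k ∧ p.2 ∈ Λ p.1} =>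
          linCovIter L U₀ (iEta η A) p.1.1 p.1.2.1 p.1.2.2)))
    (h59g : g ≤ B₀ * (bondNorm L k η (-(3 : ℝ)) Ω (fun x μ => Jcur η U₀ A μ x)
      + wsup 1 (fun p : {p : ℕ × (Site d × Fin d) // p.1 ≤ k ∧ p.2 ∈ Λ p.1} =>
          linCovIter L U₀ (iEta η A) p.1.1 p.1.2.1 p.1.2.2)))
    (h59j : j₂ ≤ B₀ * (bondNorm L k η (-(3 : ℝ)) Ω (fun x μ => Jcur η U₀ A μ x)
      + wsup 1 (fun p : {p : ℕ × (Site d × Fin d) // p.1 ≤ k ∧ p.2 ∈ Λ p.1} =>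
          linCovIter L U₀ (iEta η A) p.1.1 p.1.2.1 p.1.2.2)))
    (h59l : l ≤ B₀ * (bondNorm L k η (-(3 : ℝ)) Ω (fun x μ => Jcur η U₀ A μ x)
      + wsup 1 (fun p : {p : ℕ × (Site d × Fin d) // p.1 ≤ k ∧ p.2 ∈ Λ p.1} =>
          linCovIter L U₀ (iEta η A) p.1.1 p.1.2.1 p.1.2.2))) :
    a ≤ 5 * d * L * B₀ * (α₀ + α₁) ∧ g ≤ 5 * d * L * B₀ * (α₀ + α₁) ∧
    j₂ ≤ 5 * d * L * B₀ * (α₀ + α₁) ∧ l ≤ 5 * d * L * B₀ * (α₀ + α₁) := by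
  have hL1 : 1 ≤ L := le_trans (by norm_num) hL
  have h₀ : ∀ y κ, U₀ y κ ∈ U1 𝔸 := fun y κ => unitaryUnits_le_U1 (hU₀ y κ)
  -- (1.55) at `k` levels (`B8Eq155KLevelLocal`)
  have h55 := eq155_norm_kLevel_hermitian hη hL1 h₀ hAh hα₀.le hα₂ h16 hd5 hg0 h40₀ h40₁ h41 hg
  -- (1.56) at `k` levels (`B8Eq156KLevelLocal`), with (1.41) moved to the bonds touching `Ω_j`
  have h41' : ∀ j, j ≤ k → ∀ x μ, BondTouches (Ω j) x μ → ‖A x μ‖ ≤ α₂ * ((L : ℝ) ^ j * η)⁻¹ :=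
    fun j hj x μ hb => bound_of_sideTouches hd2 (h41 j hj) x μ hb
  have h56 := wsup_B1_le_kLevel hη L hL (avgClosed_unitaryUnits d L) U₀ hU₀ hα₀ hα3 hα4 A hα₂ hsmall hc₃ hbox h40₀
    h41' hα₁ h42
  -- the bootstrap (1.55) + (1.56) + (1.59) ⇒ (1.60), with `C₂(d, α₀)`
  obtain ⟨ha, hg', hj, hl⟩ := B8.apriori_160 (Nat.cast_nonneg d) hB₀ hα₂ hg0 h55 h56 h59a h59g h59j h59l hside h50
  -- `C₂(d, α₀) ≤ C₂`, so (1.60) holds with `C₂`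
  set R₀ := B₀ * (4 * α₀ + 4 * d * L * α₁ + 2 * α₂ ^ 2 + 20 * d * α₀ * α₂
      + 2 * (8 * (131072 * ((d : ℝ) + 1) ^ 2) * Real.exp (4 * (800 * ((d : ℝ) + 1) ^ 2 * ((d : ℝ) + 4)) * α₀))
        * α₂ ^ 2) with hR₀
  set R₁ := B₀ * (4 * α₀ + 4 * d * L * α₁ + 2 * α₂ ^ 2 + 20 * d * α₀ * α₂ + 2 * C₂ * α₂ ^ 2) with hR₁
  have hR : R₀ ≤ R₁ := by
    rw [hR₀, hR₁]
    apply mul_le_mul_of_nonneg_left _ hB₀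
    have hsq : 0 ≤ α₂ ^ 2 := sq_nonneg _
    nlinarith [mul_le_mul_of_nonneg_right hC₂ hsq]
  -- (1.60) + (1.61) ⇒ (1.62) (`B8.apriori_162`)
  have hd' : (1 : ℝ) ≤ d := by exact_mod_cast (le_trans (by norm_num) hd2)
  have hdL : (1 : ℝ) ≤ (d : ℝ) * L := by
    have hL' : (1 : ℝ) ≤ L := by exact_mod_cast hL1
    nlinarith
  have h162 : R₁ ≤ 5 * d * L * B₀ * (α₀ + α₁) := by
    rw [hR₁]
    exact B8.apriori_162 hB₀ hdL hα₀.le hα₁ h61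
  exact ⟨ha.trans (hR.trans h162), hg'.trans (hR.trans h162), hj.trans (hR.trans h162), hl.trans (hR.trans h162)⟩

/-! ## §2 (1.62) as printed, pointwise «on Ω_j» -/

omit [Nontrivial 𝔸] in
/-- **(1.62), FIRST MEMBER AS PRINTED** «|A| < 5dLB₀(α₀ + α₁)(Lʲη)⁻¹ on Ω_j», `j = 0, …, k`: when the (1.59) quantity `a` is
print's `|A|_(−1) = sup_{j ≤ k} sup_{b ∈ Ω_j}(Lʲη)|A(b)|` over the bonds touching `Ω_j` (`B8ScaledSupNorm.bondNorm … (−1)`),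
its bound `a ≤ 5dLB₀(α₀ + α₁)` gives `‖A(b)‖ ≤ 5dLB₀(α₀ + α₁)(Lʲη)⁻¹` at every bond `b` touching `Ω_j`, `j ≤ k` — the family
is bounded by (1.41) (`d ≥ 2`). [cite: Balaban1985RegularSpaces, Prop. 3 (1.62) p.87, (1.41) p.83] -/
theorem prop3_pointwise_A_kLevel (hd2 : 2 ≤ d) {η : ℝ} (hη : 0 < η) {L : ℕ} (hL : 1 ≤ L) {k : ℕ}
    {A : Site d → Fin d → 𝔸} {α₂ R : ℝ} {Ω : ℕ → Set (Site d)}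
    (h41 : ∀ j, j ≤ k → ∀ y τ, SideTouches (Ω j) y τ → ‖A y τ‖ ≤ α₂ * ((L : ℝ) ^ j * η)⁻¹)
    (ha : bondNorm L k η (-(1 : ℝ)) Ω A ≤ R) {j : ℕ} (hj : j ≤ k) {x : Site d} {μ : Fin d}
    (hb : BondTouches (Ω j) x μ) : ‖A x μ‖ ≤ R * ((L : ℝ) ^ j * η)⁻¹ := by
  have e1 : (-(1 : ℝ)) = -((1 : ℕ) : ℝ) := by norm_num
  rw [e1] at ha
  -- boundedness of the weighted family from (1.41): `(Lʲη)‖A(b)‖ ≤ α₂`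
  have hB : Bdd L k η (-((1 : ℕ) : ℝ)) (fun j (b : Site d × Fin d) => BondTouches (Ω j) b.1 b.2)
      fun b => A b.1 b.2 := by
    refine B8ScaledSupNorm.bdd_of_forall (c := α₂) fun j hj b hb => ?_
    have hs : 0 < (L : ℝ) ^ j * η := B8ScaledSupNorm.scale_pos hL hη j
    have h := bound_of_sideTouches hd2 (h41 j hj) b.1 b.2 hb
    rw [B8ScaledSupNorm.weight_neg_natCast L η 1 j, pow_one]
    calc (L : ℝ) ^ j * η * ‖A b.1 b.2‖ ≤ (L : ℝ) ^ j * η * (α₂ * ((L : ℝ) ^ j * η)⁻¹) :=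
          mul_le_mul_of_nonneg_left h hs.le
      _ = α₂ := by field_simp
  have h := B8ScaledSupNorm.pointwise_of_bondNorm_le hL hη 1 hB ha hj hb
  simpa only [pow_one] using h

omit [Nontrivial 𝔸] in
/-- **(1.62), SECOND MEMBER AS PRINTED** «|∇^η_{U₀}A| < 5dLB₀(α₀ + α₁)(Lʲη)⁻²», read on `SideTouches (Ω j)`: when the gradient
datum `g` is the weighted supremum `sup_{j ≤ k} sup_{SideTouches Ω_j}(Lʲη)²|(D^η_{U₀,κ}A_τ)(y)|` (`B8ScaledSupNorm.msup` at
exponent `−2`, bounded family), its bound `g ≤ 5dLB₀(α₀ + α₁)` gives the pointwise form at every such bond, `j ≤ k`.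
[cite: Balaban1985RegularSpaces, Prop. 3 (1.62) p.87] -/
theorem prop3_pointwise_grad_kLevel {η : ℝ} (hη : 0 < η) {L : ℕ} (hL : 1 ≤ L) {k : ℕ}
    {U₀ : Site d → Fin d → 𝔸ˣ} {A : Site d → Fin d → 𝔸} {R : ℝ} {Ω : ℕ → Set (Site d)}
    (hB : Bdd L k η (-(2 : ℝ)) (fun j (t : Fin d × Fin d × Site d) => SideTouches (Ω j) t.2.2 t.2.1)
      (fun t => covDerivFwd η U₀ t.1 (fun z => A z t.2.1) t.2.2))
    (hg : msup L k η (-(2 : ℝ)) (fun j (t : Fin d × Fin d × Site d) => SideTouches (Ω j) t.2.2 t.2.1)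
      (fun t => covDerivFwd η U₀ t.1 (fun z => A z t.2.1) t.2.2) ≤ R)
    {j : ℕ} (hj : j ≤ k) {y : Site d} {κ τ : Fin d} (hy : SideTouches (Ω j) y τ) :
    ‖covDerivFwd η U₀ κ (fun z => A z τ) y‖ ≤ R * ((L : ℝ) ^ j * η) ^ (-(2 : ℝ)) :=
  B8ScaledSupNorm.norm_le_of_msup_le hL hη hB hg hj (i := (κ, τ, y)) hy

/-! ## §2b The Hölder member «B₂(β₀) = 5dLB₀(β₀)» at `k` levels: a fifth (1.59)-type quantity with its own constant -/

/-- **(1.62), HÖLDER MEMBER, AT `k` LEVELS** («‖A‖_{1,β} < 5dLB₀(β)(α₀ + α₁)(Lʲη)^{−2−β} on Ω_j», i.e. «B₂(β₀) = 5dLB₀(β₀)»): under the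
hypotheses of `prop3_norms_kLevel` up to and including the gradient line `h59g` (constant `B₀`), ANY k-level quantity `h` obeying the
Hölder line of (1.59) with its own constant `B₀(β) = B₀β ≥ 0`, `h ≤ B₀β·(|J|_(−3) + |B₁|)` (the Hölder entries (3.43)–(3.45) of [4]
Thm 3.3 applied to (1.58); print: «B₀(β₀) … the corresponding norms of … H(U₀)»), satisfies `h ≤ 5dL·B₀β·(α₀ + α₁)` — the
arithmetic `B8Prop3Holder.apriori_160_fifth` / `apriori_162_fifth` BY NAME in the k-level currency (`h` stands for print's
`sup_j sup_{Ω_j}(Lʲη)^{2+β}‖A‖_{1,β}`; no k-level Hölder seminorm object is modelled here, cf. `B8Prop3Holder` at one level).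
[cite: Balaban1985RegularSpaces, Prop. 3 (1.62) p.87, (1.36) p.82, (1.59)–(1.61) p.86] -/
theorem prop3_fifth_kLevel (hd2 : 2 ≤ d) {η : ℝ} (hη : 0 < η) {L : ℕ} (hL : 2 ≤ L) {k : ℕ}
    {U₀ : Site d → Fin d → 𝔸ˣ} (hU₀ : ∀ y κ, U₀ y κ ∈ unitaryUnits 𝔸)
    {A : Site d → Fin d → 𝔸} (hAh : ∀ y κ, IsSelfAdjoint (A y κ)) {α₀ α₁ α₂ g : ℝ}
    (hα₀ : 0 < α₀) (hα₁ : 0 ≤ α₁) (hα₂ : 0 ≤ α₂) (hg0 : 0 ≤ g)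
    (hα3 : C0 d * α₀ ≤ 1 / 3) (hα4 : 4 * α₀ ≤ c2' d L) (h16 : 16 * α₂ ≤ 1) (hd5 : 5 * α₂ * ((d : ℝ) - 1) ≤ 4)
    (hsmall : Real.exp (4 * (800 * ((d : ℝ) + 1) ^ 2 * ((d : ℝ) + 4)) * α₀)
      * (1 + 8 * (131072 * ((d : ℝ) + 1) ^ 2) * α₂) ≤ 2)
    (hc₃ : 2 * α₂ ≤ c3 d L) {B₀ B₀β : ℝ} (hB₀ : 0 ≤ B₀) (hB₀β : 0 ≤ B₀β) (hside : 36 * d * B₀ * α₂ ≤ 1 / 2)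
    (h50 : 50 * d * α₂ ≤ 1)
    {C₂ : ℝ} (hC₂ : 8 * (131072 * ((d : ℝ) + 1) ^ 2) * Real.exp (4 * (800 * ((d : ℝ) + 1) ^ 2 * ((d : ℝ) + 4)) * α₀) ≤ C₂)
    (h61 : 2 * α₂ ^ 2 + 20 * d * α₀ * α₂ + 2 * C₂ * α₂ ^ 2 ≤ α₀ + α₁)
    {Ω : ℕ → Set (Site d)} {Λ : ℕ → Set (Site d × Fin d)}
    (hbox : ∀ j, j ≤ k → ∀ c ∈ Λ j, ∀ x, InBox (loK L j c.1) (bondHiK L j c.1 c.2) x → x ∈ Ω j)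
    (h40₀ : InAk L k η α₀ Ω U₀) (h40₁ : InAk L k η α₀ Ω (mulCfg (expCfg (iEta η A)) U₀))
    (h41 : ∀ j, j ≤ k → ∀ y τ, SideTouches (Ω j) y τ → ‖A y τ‖ ≤ α₂ * ((L : ℝ) ^ j * η)⁻¹)
    (hg : ∀ j, j ≤ k → ∀ (y : Site d) (κ τ : Fin d), SideTouches (Ω j) y τ →
      ((L : ℝ) ^ j * η) ^ 2 * ‖covDerivFwd η U₀ κ (fun z => A z τ) y‖ ≤ g)
    (h42 : ∀ j, j ≤ k → ∀ c ∈ Λ j, ‖logCovIter L U₀ (iEta η A) j c.1 c.2‖ < 2 * d * L * α₁)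
    {h : ℝ}
    (h59g : g ≤ B₀ * (bondNorm L k η (-(3 : ℝ)) Ω (fun x μ => Jcur η U₀ A μ x)
      + wsup 1 (fun p : {p : ℕ × (Site d × Fin d) // p.1 ≤ k ∧ p.2 ∈ Λ p.1} =>
          linCovIter L U₀ (iEta η A) p.1.1 p.1.2.1 p.1.2.2)))
    (h59h : h ≤ B₀β * (bondNorm L k η (-(3 : ℝ)) Ω (fun x μ => Jcur η U₀ A μ x)
      + wsup 1 (fun p : {p : ℕ × (Site d × Fin d) // p.1 ≤ k ∧ p.2 ∈ Λ p.1} =>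
          linCovIter L U₀ (iEta η A) p.1.1 p.1.2.1 p.1.2.2))) :
    h ≤ 5 * d * L * B₀β * (α₀ + α₁) := by
  have hL1 : 1 ≤ L := le_trans (by norm_num) hL
  have h₀ : ∀ y κ, U₀ y κ ∈ U1 𝔸 := fun y κ => unitaryUnits_le_U1 (hU₀ y κ)
  have h55 := eq155_norm_kLevel_hermitian hη hL1 h₀ hAh hα₀.le hα₂ h16 hd5 hg0 h40₀ h40₁ h41 hg
  have h41' : ∀ j, j ≤ k → ∀ x μ, BondTouches (Ω j) x μ → ‖A x μ‖ ≤ α₂ * ((L : ℝ) ^ j * η)⁻¹ :=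
    fun j hj x μ hb => bound_of_sideTouches hd2 (h41 j hj) x μ hb
  have h56 := wsup_B1_le_kLevel hη L hL (avgClosed_unitaryUnits d L) U₀ hU₀ hα₀ hα3 hα4 A hα₂ hsmall hc₃ hbox h40₀
    h41' hα₁ h42
  have hnB : 0 ≤ wsup 1 (fun p : {p : ℕ × (Site d × Fin d) // p.1 ≤ k ∧ p.2 ∈ Λ p.1} =>
      linCovIter L U₀ (iEta η A) p.1.1 p.1.2.1 p.1.2.2) := B8Eq155JBound.wsup_nonneg zero_le_one _
  have h160 := B8Prop3Holder.apriori_160_fifth (Nat.cast_nonneg d) hB₀ hB₀β hα₀.le hα₂ hg0 hnB h55 h56 h59g h59h hside h50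
  -- `C₂(d, α₀) ≤ C₂`
  have h160' : h ≤ B₀β * (4 * α₀ + 4 * d * L * α₁ + 2 * α₂ ^ 2 + 20 * d * α₀ * α₂ + 2 * C₂ * α₂ ^ 2) := by
    refine h160.trans (mul_le_mul_of_nonneg_left ?_ hB₀β)
    have hsq : 0 ≤ α₂ ^ 2 := sq_nonneg _
    nlinarith [mul_le_mul_of_nonneg_right hC₂ hsq]
  have hd' : (1 : ℝ) ≤ d := by exact_mod_cast (le_trans (by norm_num) hd2)
  have hdL : (1 : ℝ) ≤ (d : ℝ) * L := by
    have hL' : (1 : ℝ) ≤ L := by exact_mod_cast hL1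
    nlinarith
  exact B8Prop3Holder.apriori_162_fifth hB₀β hdL hα₀.le hα₁ h61 h160'

/-! ## §2c The Hölder member pointwise: `h` as the k-level supremum of the (1,β)-quotients of [4] (3.40) -/

omit [Nontrivial 𝔸] in
/-- **(1.62), THIRD MEMBER AS PRINTED, POINTWISE** «‖A‖_{1,β} < B₂(β)(α₀ + α₁)(Lʲη)^{−2−β} on Ω_j»: when the Hölder datum `h` of
`prop3_fifth_kLevel` is the k-level weighted supremum `sup_{j ≤ k} sup (Lʲη)^{2+β}·q_{μν}(x, x′)` of the (1,β)-quotients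
`q_{μν}(x, x′) = |x′ − x|^{−β}|R(U₀(Γ_{x,x′}))(D_μA_ν)(x′) − (D_μA_ν)(x)|` of [4] (3.40) (`B9Eq340HolderZd.hquot` of the covariant
gradient) over the admissible pairs with `x ∈ Ω_j` (`B8ScaledSupNorm.msup` at the real exponent `−(2+β)`, bounded family), its bound
`h ≤ R` gives `q_{μν}(x, x′) ≤ R·(Lʲη)^{−(2+β)}` at every such pair, `j ≤ k`.
[cite: Balaban1985RegularSpaces, Prop. 3 (1.62) p.87, (1.36) p.82; Balaban1985BackgroundPropagators, (3.40) p.397] -/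
theorem prop3_pointwise_holder_kLevel {η : ℝ} (hη : 0 < η) {L : ℕ} (hL : 1 ≤ L) {k : ℕ} {β : ℝ} {len : Site d → ℝ}
    {U₀ : Site d → Fin d → 𝔸ˣ} {A : Site d → Fin d → 𝔸} {R : ℝ} {Ω : ℕ → Set (Site d)}
    (hB : Bdd L k η (-(2 + β))
      (fun j (q : Fin d × Fin d × (Site d × Site d)) => q.2.2 ∈ B9Eq340HolderZd.AdmPair η len ∧ q.2.2.1 ∈ Ω j)
      (fun q => B9Eq340HolderZd.hquot η β len U₀ (covDerivFwd η U₀ q.1 (fun z => A z q.2.1)) q.2.2))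
    (hh : msup L k η (-(2 + β))
      (fun j (q : Fin d × Fin d × (Site d × Site d)) => q.2.2 ∈ B9Eq340HolderZd.AdmPair η len ∧ q.2.2.1 ∈ Ω j)
      (fun q => B9Eq340HolderZd.hquot η β len U₀ (covDerivFwd η U₀ q.1 (fun z => A z q.2.1)) q.2.2) ≤ R)
    {j : ℕ} (hj : j ≤ k) {μ ν : Fin d} {p : Site d × Site d} (hp : p ∈ B9Eq340HolderZd.AdmPair η len)
    (hx : p.1 ∈ Ω j) :
    B9Eq340HolderZd.hquot η β len U₀ (covDerivFwd η U₀ μ (fun z => A z ν)) p ≤ R * ((L : ℝ) ^ j * η) ^ (-(2 + β)) := by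
  have h := B8ScaledSupNorm.norm_le_of_msup_le hL hη hB hh hj (i := (μ, ν, p)) ⟨hp, hx⟩
  rwa [Real.norm_of_nonneg (B9Eq340HolderZd.hquot_nonneg hη.le β U₀ _ hp)] at h

/-! ## §3 Proposition 3 at `k` levels in print's quantifier shape: one threshold `c(d, L, B₀)` -/

omit [Nontrivial 𝔸] in
/-- From the window `e^{4cα₀}(1 + 8C₁α₂) ≤ 2` alone: `e^{4cα₀} ≤ 2`, hence the (1.56)-constant `C₂(d, α₀) = 8C₁e^{4cα₀}` is
majorised by the `α₀`-free `C₂(d) = 16C₁ = 2097152(d+1)²` (as in `B8Prop3Concrete`). [folklore] -/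
private theorem C2_le_of_window {α₀ α₂ : ℝ} (hα₂ : 0 ≤ α₂)
    (hsmall : Real.exp (4 * (800 * ((d : ℝ) + 1) ^ 2 * ((d : ℝ) + 4)) * α₀)
      * (1 + 8 * (131072 * ((d : ℝ) + 1) ^ 2) * α₂) ≤ 2) :
    8 * (131072 * ((d : ℝ) + 1) ^ 2) * Real.exp (4 * (800 * ((d : ℝ) + 1) ^ 2 * ((d : ℝ) + 4)) * α₀)
      ≤ 2097152 * ((d : ℝ) + 1) ^ 2 := by
  set E := Real.exp (4 * (800 * ((d : ℝ) + 1) ^ 2 * ((d : ℝ) + 4)) * α₀) with hE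
  have hE0 : 0 < E := Real.exp_pos _
  have hy : 0 ≤ 8 * (131072 * ((d : ℝ) + 1) ^ 2) * α₂ := by positivity
  have hE2 : E ≤ 2 := by nlinarith
  have hK : 0 ≤ 8 * (131072 * ((d : ℝ) + 1) ^ 2) := by positivity
  calc 8 * (131072 * ((d : ℝ) + 1) ^ 2) * E ≤ 8 * (131072 * ((d : ℝ) + 1) ^ 2) * 2 :=
        mul_le_mul_of_nonneg_left hE2 hK
    _ = 2097152 * ((d : ℝ) + 1) ^ 2 := by ring

omit [Nontrivial 𝔸] in
/-- The [3]-Prop.-4 window `e^{x}(1 + y) ≤ 2` from `0 ≤ x ≤ 1/10`, `0 ≤ y ≤ 1/2` (as in `B8Prop3Concrete`). [folklore] -/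
private theorem exp_window {x y : ℝ} (hx0 : 0 ≤ x) (hx : x ≤ 1 / 10) (hy0 : 0 ≤ y) (hy : y ≤ 1 / 2) :
    Real.exp x * (1 + y) ≤ 2 := by
  have h := Real.abs_exp_sub_one_le (x := x) (by rw [abs_of_nonneg hx0]; linarith)
  rw [abs_of_nonneg hx0] at h
  have h2 : Real.exp x ≤ 1 + 2 * x := by linarith [(abs_le.mp h).2]
  have h3 : Real.exp x ≤ 6 / 5 := by linarith
  calc Real.exp x * (1 + y) ≤ 6 / 5 * (1 + 1 / 2) := by
        gcongr
    _ ≤ 2 := by norm_num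

/-- **PROPOSITION 3 (p. 87) AT `k` LEVELS FOR A GENERAL FAMILY `{Ω_j}_{j ≤ k}` AND A GENERAL UNITARY BACKGROUND**, in print's
quantifier shape: «α₀, α₁, α₂ bounded by a constant depending on d and L only» made explicit as ONE threshold
`c = c(d, L, B₀) > 0` (`B₀` «depends on d and L only»),
`c = min{1/(24C₀(d)), c₂′(d,L)/16, 1/(32000(d+1)²(d+4)), 1/(2097152(d+1)²), c₃(d,L)/2, 1/(80d), 1/(72d(B₀+1))}` — the threshold of
the one-level `B8Prop3Concrete.prop3_concrete` —; for all `0 < α₀, α₁, α₂ ≤ c` with (1.61) (`C₂ = C₂(d) = 2097152(d+1)²`), every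
unitary-valued `U₀`, Hermitian `A`, site domains `Ω` and constraint bonds `Λ` (boxes in `Ω_j`) satisfying the LEVEL-WISE
(1.40)–(1.42) («on Ω_j», «on Λ_j», `j = 0, …, k`), every gradient datum `g ≥ 0` and the four (1.59) bounds of Theorem 3.3 of
[4] in the k-level currency: (1.62) = (1.36)/(1.39) with `B₁ = 5dLB₀` in norm form, `a, g, j₂, l ≤ 5dLB₀(α₀ + α₁)`, and the
first member pointwise AS PRINTED when `a = |A|_(−1)`: `‖A(b)‖ ≤ 5dLB₀(α₀ + α₁)(Lʲη)⁻¹` for every bond `b` touching `Ω_j`,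
`j ≤ k`. [cite: Balaban1985RegularSpaces, Prop. 3 p.87; (1.40)–(1.42) p.83; (1.59)–(1.62) pp.86–87] -/
theorem prop3_kLevel (hd2 : 2 ≤ d) {η : ℝ} (hη : 0 < η) {L : ℕ} (hL : 2 ≤ L) (k : ℕ) {B₀ : ℝ} (hB₀ : 0 ≤ B₀) :
    ∃ c : ℝ, 0 < c ∧ ∀ ⦃α₀ α₁ α₂ : ℝ⦄, 0 < α₀ → α₀ ≤ c → 0 < α₁ → α₁ ≤ c → 0 < α₂ → α₂ ≤ c →
      2 * α₂ ^ 2 + 20 * d * α₀ * α₂ + 2 * (2097152 * ((d : ℝ) + 1) ^ 2) * α₂ ^ 2 ≤ α₀ + α₁ →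
      ∀ (U₀ : Site d → Fin d → 𝔸ˣ), (∀ y κ, U₀ y κ ∈ unitaryUnits 𝔸) →
      ∀ (A : Site d → Fin d → 𝔸), (∀ y κ, IsSelfAdjoint (A y κ)) →
      ∀ (Ω : ℕ → Set (Site d)) (Λ : ℕ → Set (Site d × Fin d)),
      (∀ j, j ≤ k → ∀ c ∈ Λ j, ∀ x, InBox (loK L j c.1) (bondHiK L j c.1 c.2) x → x ∈ Ω j) →
      InAk L k η α₀ Ω U₀ → InAk L k η α₀ Ω (mulCfg (expCfg (iEta η A)) U₀) →
      (∀ j, j ≤ k → ∀ y τ, SideTouches (Ω j) y τ → ‖A y τ‖ ≤ α₂ * ((L : ℝ) ^ j * η)⁻¹) →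
      (∀ j, j ≤ k → ∀ c ∈ Λ j, ‖logCovIter L U₀ (iEta η A) j c.1 c.2‖ < 2 * d * L * α₁) →
      ∀ ⦃g : ℝ⦄, 0 ≤ g →
      (∀ j, j ≤ k → ∀ (y : Site d) (κ τ : Fin d), SideTouches (Ω j) y τ →
        ((L : ℝ) ^ j * η) ^ 2 * ‖covDerivFwd η U₀ κ (fun z => A z τ) y‖ ≤ g) →
      ∀ ⦃a j₂ l : ℝ⦄,
      a ≤ B₀ * (bondNorm L k η (-(3 : ℝ)) Ω (fun x μ => Jcur η U₀ A μ x)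
        + wsup 1 (fun p : {p : ℕ × (Site d × Fin d) // p.1 ≤ k ∧ p.2 ∈ Λ p.1} =>
            linCovIter L U₀ (iEta η A) p.1.1 p.1.2.1 p.1.2.2)) →
      g ≤ B₀ * (bondNorm L k η (-(3 : ℝ)) Ω (fun x μ => Jcur η U₀ A μ x)
        + wsup 1 (fun p : {p : ℕ × (Site d × Fin d) // p.1 ≤ k ∧ p.2 ∈ Λ p.1} =>
            linCovIter L U₀ (iEta η A) p.1.1 p.1.2.1 p.1.2.2)) →
      j₂ ≤ B₀ * (bondNorm L k η (-(3 : ℝ)) Ω (fun x μ => Jcur η U₀ A μ x)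
        + wsup 1 (fun p : {p : ℕ × (Site d × Fin d) // p.1 ≤ k ∧ p.2 ∈ Λ p.1} =>
            linCovIter L U₀ (iEta η A) p.1.1 p.1.2.1 p.1.2.2)) →
      l ≤ B₀ * (bondNorm L k η (-(3 : ℝ)) Ω (fun x μ => Jcur η U₀ A μ x)
        + wsup 1 (fun p : {p : ℕ × (Site d × Fin d) // p.1 ≤ k ∧ p.2 ∈ Λ p.1} =>
            linCovIter L U₀ (iEta η A) p.1.1 p.1.2.1 p.1.2.2)) →
      (a ≤ 5 * d * L * B₀ * (α₀ + α₁) ∧ g ≤ 5 * d * L * B₀ * (α₀ + α₁) ∧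
        j₂ ≤ 5 * d * L * B₀ * (α₀ + α₁) ∧ l ≤ 5 * d * L * B₀ * (α₀ + α₁)) ∧
      (a = bondNorm L k η (-(1 : ℝ)) Ω A →
        ∀ j, j ≤ k → ∀ x μ, BondTouches (Ω j) x μ → ‖A x μ‖ ≤ 5 * d * L * B₀ * (α₀ + α₁) * ((L : ℝ) ^ j * η)⁻¹) := by
  have hd : 1 ≤ d := le_trans (by norm_num) hd2
  have hd' : (1 : ℝ) ≤ d := by exact_mod_cast hd
  have hd0 : (0 : ℝ) < d := by linarith
  have hL1 : 1 ≤ L := le_trans (by norm_num) hL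
  have hC0 := B7Prop2Explicit.C0_pos d
  have hc2 : 0 < c2' d L := B7Prop2Explicit.c2'_pos d L hL1
  have hc3 : 0 < c3 d L := B7Prop3Flat.c3_pos d hL1
  refine ⟨min (1 / (24 * C0 d)) (min (c2' d L / 16) (min (1 / (32000 * ((d : ℝ) + 1) ^ 2 * ((d : ℝ) + 4)))
    (min (1 / (2097152 * ((d : ℝ) + 1) ^ 2)) (min (c3 d L / 2) (min (1 / (80 * (d : ℝ)))
    (1 / (72 * (d : ℝ) * (B₀ + 1)))))))), ?_, ?_⟩
  · refine lt_min (by positivity) (lt_min (by positivity) (lt_min (by positivity) (lt_min (by positivity)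
      (lt_min (by positivity) (lt_min (by positivity) (by positivity))))))
  intro α₀ α₁ α₂ hα₀ hα₀c hα₁ hα₁c hα₂ hα₂c h61 U₀ hU₀ A hAh Ω Λ hbox h40₀ h40₁ h41 h42 g hg0 hg a j₂ l
    h59a h59g h59j h59l
  simp only [le_min_iff] at hα₀c hα₂c
  obtain ⟨h24₀, h16₀, h32₀, -, -, -, -⟩ := hα₀c
  obtain ⟨-, -, -, h21₂, hc3₂, h80₂, h72₂⟩ := hα₂c
  -- the windows (as in `B8Prop3Concrete.prop3_concrete`)
  have hα3 : C0 d * α₀ ≤ 1 / 3 := by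
    have e : C0 d * (1 / (24 * C0 d)) = 1 / 24 := by field_simp
    have := (mul_le_mul_of_nonneg_left h24₀ hC0.le).trans_eq e
    linarith
  have hα4 : 4 * α₀ ≤ c2' d L := by linarith
  have h80 : α₂ ≤ 1 / 80 := by
    have : (1 : ℝ) / (80 * d) ≤ 1 / 80 := by
      rw [div_le_div_iff₀ (by positivity) (by norm_num)]; nlinarith
    exact h80₂.trans this
  have h16 : 16 * α₂ ≤ 1 := by linarith
  have hdα : (d : ℝ) * α₂ ≤ 1 / 80 := by
    have := mul_le_mul_of_nonneg_left h80₂ hd0.le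
    have e : (d : ℝ) * (1 / (80 * d)) = 1 / 80 := by field_simp
    linarith [this.trans_eq e]
  have h50 : 50 * d * α₂ ≤ 1 := by nlinarith
  have hd5 : 5 * α₂ * ((d : ℝ) - 1) ≤ 4 := by nlinarith
  have hside : 36 * d * B₀ * α₂ ≤ 1 / 2 := by
    have h1 : 36 * d * B₀ * α₂ ≤ 36 * d * B₀ * (1 / (72 * (d : ℝ) * (B₀ + 1))) :=
      mul_le_mul_of_nonneg_left h72₂ (by positivity)
    have e : 36 * d * B₀ * (1 / (72 * (d : ℝ) * (B₀ + 1))) = B₀ / (2 * (B₀ + 1)) := by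
      field_simp
      ring
    have h2 : B₀ / (2 * (B₀ + 1)) ≤ 1 / 2 := by
      rw [div_le_div_iff₀ (by positivity) (by norm_num)]; nlinarith
    linarith [h1.trans_eq e]
  have hsmall : Real.exp (4 * (800 * ((d : ℝ) + 1) ^ 2 * ((d : ℝ) + 4)) * α₀)
      * (1 + 8 * (131072 * ((d : ℝ) + 1) ^ 2) * α₂) ≤ 2 := by
    have hx0 : 0 ≤ 4 * (800 * ((d : ℝ) + 1) ^ 2 * ((d : ℝ) + 4)) * α₀ := by positivity
    have hx : 4 * (800 * ((d : ℝ) + 1) ^ 2 * ((d : ℝ) + 4)) * α₀ ≤ 1 / 10 := by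
      have h := mul_le_mul_of_nonneg_left h32₀ (by positivity : (0 : ℝ) ≤ 3200 * (((d : ℝ) + 1) ^ 2 * ((d : ℝ) + 4)))
      have e : (3200 * (((d : ℝ) + 1) ^ 2 * ((d : ℝ) + 4))) * (1 / (32000 * ((d : ℝ) + 1) ^ 2 * ((d : ℝ) + 4)))
          = 1 / 10 := by
        field_simp; ring
      have e' : 4 * (800 * ((d : ℝ) + 1) ^ 2 * ((d : ℝ) + 4)) * α₀
          = (3200 * (((d : ℝ) + 1) ^ 2 * ((d : ℝ) + 4))) * α₀ := by ring
      rw [e']; exact h.trans_eq e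
    have hy0 : 0 ≤ 8 * (131072 * ((d : ℝ) + 1) ^ 2) * α₂ := by positivity
    have hy : 8 * (131072 * ((d : ℝ) + 1) ^ 2) * α₂ ≤ 1 / 2 := by
      have h := mul_le_mul_of_nonneg_left h21₂ (by positivity : (0 : ℝ) ≤ 1048576 * ((d : ℝ) + 1) ^ 2)
      have e : (1048576 * ((d : ℝ) + 1) ^ 2) * (1 / (2097152 * ((d : ℝ) + 1) ^ 2)) = 1 / 2 := by
        field_simp; ring
      have e' : 8 * (131072 * ((d : ℝ) + 1) ^ 2) * α₂ = (1048576 * ((d : ℝ) + 1) ^ 2) * α₂ := by ring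
      rw [e']; exact h.trans_eq e
    exact exp_window hx0 hx hy0 hy
  have hc₃ : 2 * α₂ ≤ c3 d L := by linarith
  have hC := C2_le_of_window (d := d) hα₂.le hsmall
  have hN := prop3_norms_kLevel hd2 hη hL hU₀ hAh hα₀ hα₁.le hα₂.le hg0 hα3 hα4 h16 hd5 hsmall hc₃ hB₀ hside h50 hC
    h61 hbox h40₀ h40₁ h41 hg h42 h59a h59g h59j h59l
  refine ⟨hN, fun ha j hj x μ hb => ?_⟩
  have hA : bondNorm L k η (-(1 : ℝ)) Ω A ≤ 5 * d * L * B₀ * (α₀ + α₁) := by rw [← ha]; exact hN.1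
  exact prop3_pointwise_A_kLevel hd2 hη hL1 h41 hA hj hb

/-! ## §4 (1.41) and the gradient datum in the LITERAL p. 77 convention: Proposition 3 at `k` levels with constants `×L²` -/

/-- **(1.62), NORM FORM AT `k` LEVELS, WITH (1.41) AND THE GRADIENT DATUM READ IN PRINT'S LITERAL BOND CONVENTION** (a bond belongs
to `Ω_j` iff one end-point does) along a family with `Ω₀ = T_η` and the one-layer nesting `SideTouches (Ω (i+1)) ⊆ BondTouches (Ω i)`
(`i < k`; e.g. a `B8ConstraintBonds.DomainSeq`, `B8Prop7ClassAkDomainSeq.sideTouches_succ_bondTouches_of_domainSeq`): the located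
reading (i) is DISCHARGED at the price of the constants — `prop3_norms_kLevel` applied with `α₂ ↦ Lα₂`, `g ↦ L²g`
(`B8Eq155KLevelLiteral.bound_side_of_lit` / `grad_side_of_lit`) and the (1.59) constant `B₀ ↦ L²B₀`, so that every window and (1.61)
are stated for `Lα₂` and the conclusion reads `a, L²g, j₂, l ≤ 5dL·(L²B₀)·(α₀ + α₁)`.
[cite: Balaban1985RegularSpaces, Prop. 3 (1.62) p.87, (1.41) p.83, p.77 (bond convention), (1.3)-(1.4) p.77] -/
theorem prop3_norms_kLevel_literal (hd2 : 2 ≤ d) {η : ℝ} (hη : 0 < η) {L : ℕ} (hL : 2 ≤ L) {k : ℕ}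
    {U₀ : Site d → Fin d → 𝔸ˣ} (hU₀ : ∀ y κ, U₀ y κ ∈ unitaryUnits 𝔸)
    {A : Site d → Fin d → 𝔸} (hAh : ∀ y κ, IsSelfAdjoint (A y κ)) {α₀ α₁ α₂ g : ℝ}
    (hα₀ : 0 < α₀) (hα₁ : 0 ≤ α₁) (hα₂ : 0 ≤ α₂) (hg0 : 0 ≤ g)
    (hα3 : C0 d * α₀ ≤ 1 / 3) (hα4 : 4 * α₀ ≤ c2' d L) (h16 : 16 * ((L : ℝ) * α₂) ≤ 1)
    (hd5 : 5 * ((L : ℝ) * α₂) * ((d : ℝ) - 1) ≤ 4)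
    (hsmall : Real.exp (4 * (800 * ((d : ℝ) + 1) ^ 2 * ((d : ℝ) + 4)) * α₀)
      * (1 + 8 * (131072 * ((d : ℝ) + 1) ^ 2) * ((L : ℝ) * α₂)) ≤ 2)
    (hc₃ : 2 * ((L : ℝ) * α₂) ≤ c3 d L) {B₀ : ℝ} (hB₀ : 0 ≤ B₀)
    (hside : 36 * d * ((L : ℝ) ^ 2 * B₀) * ((L : ℝ) * α₂) ≤ 1 / 2) (h50 : 50 * d * ((L : ℝ) * α₂) ≤ 1)
    {C₂ : ℝ} (hC₂ : 8 * (131072 * ((d : ℝ) + 1) ^ 2) * Real.exp (4 * (800 * ((d : ℝ) + 1) ^ 2 * ((d : ℝ) + 4)) * α₀) ≤ C₂)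
    (h61 : 2 * ((L : ℝ) * α₂) ^ 2 + 20 * d * α₀ * ((L : ℝ) * α₂) + 2 * C₂ * ((L : ℝ) * α₂) ^ 2 ≤ α₀ + α₁)
    {Ω : ℕ → Set (Site d)} {Λ : ℕ → Set (Site d × Fin d)} (hΩ₀ : Ω 0 = Set.univ)
    (hnest : ∀ i, i < k → ∀ (y : Site d) (τ : Fin d), SideTouches (Ω (i + 1)) y τ → BondTouches (Ω i) y τ)
    (hbox : ∀ j, j ≤ k → ∀ c ∈ Λ j, ∀ x, InBox (loK L j c.1) (bondHiK L j c.1 c.2) x → x ∈ Ω j)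
    (h40₀ : InAk L k η α₀ Ω U₀) (h40₁ : InAk L k η α₀ Ω (mulCfg (expCfg (iEta η A)) U₀))
    (h41 : ∀ j, j ≤ k → ∀ x μ, BondTouches (Ω j) x μ → ‖A x μ‖ ≤ α₂ * ((L : ℝ) ^ j * η)⁻¹)
    (hg : ∀ j, j ≤ k → ∀ (y : Site d) (κ τ : Fin d), BondTouches (Ω j) y τ →
      ((L : ℝ) ^ j * η) ^ 2 * ‖covDerivFwd η U₀ κ (fun z => A z τ) y‖ ≤ g)
    (h42 : ∀ j, j ≤ k → ∀ c ∈ Λ j, ‖logCovIter L U₀ (iEta η A) j c.1 c.2‖ < 2 * d * L * α₁)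
    {a j₂ l : ℝ}
    (h59a : a ≤ B₀ * (bondNorm L k η (-(3 : ℝ)) Ω (fun x μ => Jcur η U₀ A μ x)
      + wsup 1 (fun p : {p : ℕ × (Site d × Fin d) // p.1 ≤ k ∧ p.2 ∈ Λ p.1} =>
          linCovIter L U₀ (iEta η A) p.1.1 p.1.2.1 p.1.2.2)))
    (h59g : g ≤ B₀ * (bondNorm L k η (-(3 : ℝ)) Ω (fun x μ => Jcur η U₀ A μ x)
      + wsup 1 (fun p : {p : ℕ × (Site d × Fin d) // p.1 ≤ k ∧ p.2 ∈ Λ p.1} =>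
          linCovIter L U₀ (iEta η A) p.1.1 p.1.2.1 p.1.2.2)))
    (h59j : j₂ ≤ B₀ * (bondNorm L k η (-(3 : ℝ)) Ω (fun x μ => Jcur η U₀ A μ x)
      + wsup 1 (fun p : {p : ℕ × (Site d × Fin d) // p.1 ≤ k ∧ p.2 ∈ Λ p.1} =>
          linCovIter L U₀ (iEta η A) p.1.1 p.1.2.1 p.1.2.2)))
    (h59l : l ≤ B₀ * (bondNorm L k η (-(3 : ℝ)) Ω (fun x μ => Jcur η U₀ A μ x)
      + wsup 1 (fun p : {p : ℕ × (Site d × Fin d) // p.1 ≤ k ∧ p.2 ∈ Λ p.1} =>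
          linCovIter L U₀ (iEta η A) p.1.1 p.1.2.1 p.1.2.2))) :
    a ≤ 5 * d * L * ((L : ℝ) ^ 2 * B₀) * (α₀ + α₁) ∧ (L : ℝ) ^ 2 * g ≤ 5 * d * L * ((L : ℝ) ^ 2 * B₀) * (α₀ + α₁) ∧
    j₂ ≤ 5 * d * L * ((L : ℝ) ^ 2 * B₀) * (α₀ + α₁) ∧ l ≤ 5 * d * L * ((L : ℝ) ^ 2 * B₀) * (α₀ + α₁) := by
  have hL1 : 1 ≤ L := le_trans (by norm_num) hL
  have hL2 : (1 : ℝ) ≤ (L : ℝ) ^ 2 := one_le_pow₀ (by exact_mod_cast hL1)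
  -- (1.41) and the gradient datum moved to `SideTouches (Ω j)` with `Lα₂`, `L²g`
  have h41' := B8Eq155KLevelLiteral.bound_side_of_lit hL1 hη hα₂ hΩ₀ hnest h41
  have hg' := B8Eq155KLevelLiteral.grad_side_of_lit (U₀ := U₀) (A := A) hL1 hη hg0 hΩ₀ hnest hg
  -- the (1.59) lines weakened to the constant `L²B₀`
  set N := bondNorm L k η (-(3 : ℝ)) Ω (fun x μ => Jcur η U₀ A μ x)
      + wsup 1 (fun p : {p : ℕ × (Site d × Fin d) // p.1 ≤ k ∧ p.2 ∈ Λ p.1} =>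
          linCovIter L U₀ (iEta η A) p.1.1 p.1.2.1 p.1.2.2) with hN
  have hN0 : 0 ≤ N := by
    rw [hN]
    exact add_nonneg (B8ScaledSupNorm.msup_nonneg L k hη.le _ _ _) (B8Eq155JBound.wsup_nonneg zero_le_one _)
  have hup : B₀ * N ≤ (L : ℝ) ^ 2 * B₀ * N := by
    have : B₀ * N ≤ (L : ℝ) ^ 2 * (B₀ * N) := le_mul_of_one_le_left (mul_nonneg hB₀ hN0) hL2
    linarith [this, mul_assoc ((L : ℝ) ^ 2) B₀ N]
  have h59a' : a ≤ (L : ℝ) ^ 2 * B₀ * N := h59a.trans hup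
  have h59g' : (L : ℝ) ^ 2 * g ≤ (L : ℝ) ^ 2 * B₀ * N := by
    have := mul_le_mul_of_nonneg_left h59g (by positivity : (0 : ℝ) ≤ (L : ℝ) ^ 2)
    linarith [this, mul_assoc ((L : ℝ) ^ 2) B₀ N]
  have h59j' : j₂ ≤ (L : ℝ) ^ 2 * B₀ * N := h59j.trans hup
  have h59l' : l ≤ (L : ℝ) ^ 2 * B₀ * N := h59l.trans hup
  rw [hN] at h59a' h59g' h59j' h59l'
  exact prop3_norms_kLevel hd2 hη hL hU₀ hAh hα₀ hα₁ (by positivity) (by positivity) hα3 hα4 h16 hd5 hsmall hc₃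
    (by positivity) hside h50 hC₂ h61 hbox h40₀ h40₁ h41' hg' h42 h59a' h59g' h59j' h59l'

#print axioms prop3_norms_kLevel
#print axioms prop3_pointwise_A_kLevel
#print axioms prop3_pointwise_grad_kLevel
#print axioms prop3_fifth_kLevel
#print axioms prop3_pointwise_holder_kLevel
#print axioms prop3_kLevel
#print axioms prop3_norms_kLevel_literal

end Literature.MathematicalPhysics.QuantumFieldTheory.Balaban1983to89.B8Prop3KLevel

end
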